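import Mathlib
import Summits.NavierStokesRegularity.NavierStokesRegularity.Theorems.EulerZoomLiouvillePowerGaugeEulerLiouvilleNeedleRaceMemberPast
import Summits.NavierStokesRegularity.NavierStokesRegularity.Theorems.EulerZoomLiouvillePowerGaugeEulerLiouvilleNeedleAxisymThinFastExits
import HarnessLib.Audit

/-!
# Crux E `EulerZoomLiouville.PowerGaugeEulerLiouville` — THE AXISYMMETRIC SWIRL-FREE `C²` NEEDLE STRATUM IS EMPTY
# (ROUND-37 (S37), unconditional): an exactly self-similar member of Seregin's power-gauged ancient Euler
# class with an axisymmetric swirl-free `C²` velocity profile is trivial — no size, tameness or `ω_θ/r` hypothesis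

Route №10 `EulerZoomLiouville` (NavierStokesRegularity), crux E = stmt-NavierStokesRegularity-19832,
registered residue `stub_selfSimilarC2Needle` (THE ONE STATEMENT); memo ROUND-37 «THE FEEDING-TIME RACE» of
the cell `ns-regularity-ideate` (text custody nsreg-p2 g32), statement (S37) = the D2 model class of the
LEAD's RESIDUE-MEMO-19832-g11 §2.  Assembly BY NAME of the two halves of ROUND-37:

* (K) THIN FAST EXITS (nsreg-p2, plates t38h/t38i/t38j: `NeedleAxisymBand.thinFastExits`) — an axisymmetric
  `C¹` field with polynomial energy and Dirichlet ball budgets has super-polynomially thin γ-fast exits;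
* (R) THE RACE (this seat: `NeedleRace.selfSimilar_ae_eq_zero_of_axisymNoSwirl_thinFastExits` and its past
  twin `…_past`) — with thin fast exits, the Casimir clock of an axisymmetric swirl-free `C²` profile beats
  the Jacobian and the member is trivial;

the budgets being read off the class gauges (`NeedleThinCore.selfSimilar_needle_inputs`,
`NeedleRace.lintegral_fderiv_sq_closedBall_le`; past: `Shifted.profile_energy_growth_of_gaugeA_past`,
`NeedleRace.lintegral_fderiv_sq_ball_le_of_past`).

* **`selfSimilar_ae_eq_zero_of_axisymNoSwirlC2`** — crux hypotheses verbatim (`0 < ρ ≤ ½`: suitable weak Euler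
  pair on `(−∞,0) × ℝ³`, weak spatial gradient `H`, power gauges `a^{2ρ}A + a^{ρ}E + a^{2ρ}D ≤ c`) + exact
  self-similarity about the origin with profile `(V, P)` + `V ∈ C²`, `IsAxisymmetric V`, `HasNoSwirl V`
  ⇒ `u = 0` a.e. on the slab.  Binder shape for the lead skeleton:
  `InClass ρ u p H c → IsExactlySelfSimilar ρ u p V P → ContDiff ℝ 2 V → IsAxisymmetric V → HasNoSwirl V → u =ᵐ 0`.
* **`selfSimilar_ae_eq_zero_of_axisymNoSwirlC2_past`** — the same for members exactly self-similar about
  `(T, x₀)` on a past sub-slab `τ < T₁` (`T₁ ≤ 0`, `T₁ ≤ T`).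

`C²` is load-bearing (ROUND-37 (K6)): Elgindi's `C^{1,α}` axisymmetric swirl-free self-similar Euler blow-up
has `ω_θ/r` unbounded at the axis and sits just outside the stratum.  NOT NS, not E, not the general needle
(which escapes by porosity of the fast set and by vortex stretching, ROUND-37 §3): a model-class kill inside
THE ONE STATEMENT; 19832 OPEN.  References: Constantin–Ignatova–Vicol arXiv:2602.17570 §3.4–§3.5
[ConstantinIgnatovaVicol2026Putative]; KNSS 2009 Remark 5.1 [KochNadirashviliSereginSverak2009].
-/

noncomputable section

-- the summit and its single problem share the name `NavierStokesRegularity` (D-0017 nested layout)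
set_option linter.dupNamespace false

open Set Filter Topology Metric Function MeasureTheory InnerProductSpace
open scoped RealInnerProductSpace NNReal ENNReal

namespace Summit.NavierStokesRegularity.NavierStokesRegularity.Theorems.PowerGaugeEulerLiouville.NeedleRace

open Literature.Analysis Literature.Analysis.FluidPDE
open Summit.NavierStokesRegularity.NavierStokesRegularity.Theorems.PowerGaugeEulerLiouville

variable {V : EuclideanSpace ℝ (Fin 3) → EuclideanSpace ℝ (Fin 3)}

/-! ### From growth on large open balls to growth on all closed balls `L ≥ 1` -/

/-- **Small-scale patch**: a growth `∫⁻_{B_L} F ≤ C L^q` for `L ≥ L₁` (`L₁ ≥ 2`, `C < ∞`) gives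
`∫⁻_{B̄_L} F ≤ (C L₁^q) L^q` for every `L ≥ 1` (`B̄_L ⊆ B_{L₁ L}`). [folklore] -/
theorem lintegral_closedBall_le_of_ballGrowth {F : EuclideanSpace ℝ (Fin 3) → ℝ≥0∞} {C : ℝ≥0∞} (hC : C ≠ ⊤)
    {L₁ q : ℝ} (hL₁ : 2 ≤ L₁)
    (hgrowth : ∀ L : ℝ, L₁ ≤ L →
      ∫⁻ z in ball (0 : EuclideanSpace ℝ (Fin 3)) L, F z ≤ C * ENNReal.ofReal (L ^ q))
    {L : ℝ} (hL : 1 ≤ L) :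
    ∫⁻ z in closedBall (0 : EuclideanSpace ℝ (Fin 3)) L, F z ≤ ENNReal.ofReal (C.toReal * L₁ ^ q * L ^ q) := by
  have hL0 : 0 < L := by linarith
  have hL₁0 : 0 < L₁ := by linarith
  have hLL : closedBall (0 : EuclideanSpace ℝ (Fin 3)) L ⊆ ball 0 (L₁ * L) :=
    closedBall_subset_ball (by nlinarith)
  have hL₁L : L₁ ≤ L₁ * L := le_mul_of_one_le_right hL₁0.le hL
  calc ∫⁻ z in closedBall (0 : EuclideanSpace ℝ (Fin 3)) L, F z
      ≤ ∫⁻ z in ball (0 : EuclideanSpace ℝ (Fin 3)) (L₁ * L), F z := lintegral_mono_set hLL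
    _ ≤ C * ENNReal.ofReal ((L₁ * L) ^ q) := hgrowth _ hL₁L
    _ = ENNReal.ofReal (C.toReal * L₁ ^ q * L ^ q) := by
        rw [Real.mul_rpow hL₁0.le hL0.le]
        conv_lhs => rw [← ENNReal.ofReal_toReal hC]
        rw [← ENNReal.ofReal_mul ENNReal.toReal_nonneg]
        congr 1
        ring

/-! ### Member level, centred: (S37) unconditional -/

/-- **THE AXISYMMETRIC SWIRL-FREE `C²` NEEDLE STRATUM IS EMPTY (ROUND-37 (S37)).**  An exactly self-similar member of
Seregin's power-gauged ancient Euler class (`0 < ρ ≤ ½`, crux hypotheses verbatim) whose velocity profile is `C²`,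
AXISYMMETRIC and SWIRL-FREE is trivial: `u = 0` a.e. on `(−∞,0) × ℝ³`.  (K) `NeedleAxisymBand.thinFastExits` on the
class budgets + (R) `selfSimilar_ae_eq_zero_of_axisymNoSwirl_thinFastExits`.
[cite: ConstantinIgnatovaVicol2026Putative, §3.4.1 eq. (3.21)-(3.22), §3.5] -/
theorem selfSimilar_ae_eq_zero_of_axisymNoSwirlC2 {ρ : ℝ} (hρ : 0 < ρ) (hρ1 : ρ ≤ 1 / 2)
    {u : ℝ → EuclideanSpace ℝ (Fin 3) → EuclideanSpace ℝ (Fin 3)} {p : ℝ → EuclideanSpace ℝ (Fin 3) → ℝ}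
    {H : ℝ → EuclideanSpace ℝ (Fin 3) → EuclideanSpace ℝ (Fin 3) →L[ℝ] EuclideanSpace ℝ (Fin 3)} {c : ℝ≥0}
    (hsw : IsSuitableWeakSolutionOn (slab (EuclideanSpace ℝ (Fin 3)) (Iio 0) isOpen_Iio) 0 0 u p)
    (hH : HasWeakSpatialGradientOn (slab (EuclideanSpace ℝ (Fin 3)) (Iio 0) isOpen_Iio) u H)
    (hgauge : ∀ a : ℝ, 0 < a →
      ENNReal.ofReal (a ^ (2 * ρ)) * cknA a (0 : ℝ × EuclideanSpace ℝ (Fin 3)) u +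
          ENNReal.ofReal (a ^ ρ) * cknE a (0 : ℝ × EuclideanSpace ℝ (Fin 3)) H +
        ENNReal.ofReal (a ^ (2 * ρ)) * cknD a (0 : ℝ × EuclideanSpace ℝ (Fin 3)) p ≤ (c : ℝ≥0∞))
    {P : EuclideanSpace ℝ (Fin 3) → ℝ}
    (hu : ∀ τ : ℝ, τ < 0 → u τ = selfSimilarCollapse (1 / (2 + ρ)) 0 V τ)
    (hp : ∀ τ : ℝ, τ < 0 → p τ = selfSimilarCollapsePressure (1 / (2 + ρ)) 0 P τ)
    (hV : ContDiff ℝ 2 V) (hax : IsAxisymmetric V) (hns : HasNoSwirl V) :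
    uncurry u =ᵐ[volume.restrict (Iio (0 : ℝ) ×ˢ (univ : Set (EuclideanSpace ℝ (Fin 3))))] 0 := by
  have hρ1' : ρ < 1 := by linarith
  have h2ρ : (0 : ℝ) < 2 + ρ := by linarith
  have hγ : (0 : ℝ) < 1 / (2 + ρ) := one_div_pos.2 h2ρ
  have h1ρ : 0 ≤ 1 - ρ := by linarith
  -- the class budgets of the profile
  obtain ⟨hA', hE'⟩ :=
    NeedleThinCore.selfSimilar_needle_inputs hρ hρ1' hsw hH hgauge hu hp (hV.of_le one_le_two)
  have hbA : ∀ L : ℝ, 1 ≤ L →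
      ∫⁻ z in closedBall (0 : EuclideanSpace ℝ (Fin 3)) L, ‖V z‖ₑ ^ 2 ≤
        ENNReal.ofReal ((c : ℝ) * 2 ^ (1 - 2 * ρ) * L ^ (1 - 2 * ρ)) := by
    intro L hL
    have hL0 : 0 < L := by linarith
    calc ∫⁻ z in closedBall (0 : EuclideanSpace ℝ (Fin 3)) L, ‖V z‖ₑ ^ 2
        ≤ ∫⁻ z in ball (0 : EuclideanSpace ℝ (Fin 3)) (2 * L), ‖V z‖ₑ ^ 2 :=
          lintegral_mono_set (closedBall_subset_ball (by linarith))
      _ ≤ (c : ℝ≥0∞) * ENNReal.ofReal ((2 * L) ^ (1 - 2 * ρ)) := hA' (2 * L) (by linarith)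
      _ = ENNReal.ofReal ((c : ℝ) * 2 ^ (1 - 2 * ρ) * L ^ (1 - 2 * ρ)) := by
          rw [Real.mul_rpow two_pos.le hL0.le, ← ENNReal.ofReal_coe_nnreal,
            ← ENNReal.ofReal_mul (NNReal.coe_nonneg c)]
          congr 1
          ring
  have hE0 : 0 ≤ (1 - ρ) / (2 + ρ) * (c : ℝ) := by positivity
  have hbE : ∀ L : ℝ, 1 ≤ L →
      ∫⁻ z in closedBall (0 : EuclideanSpace ℝ (Fin 3)) L, ‖fderiv ℝ V z‖ₑ ^ 2 ≤
        ENNReal.ofReal ((1 - ρ) / (2 + ρ) * (c : ℝ) * L ^ (1 - ρ)) :=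
    fun L hL => lintegral_fderiv_sq_closedBall_le hρ1' hE0 hE' hL
  -- (K): thin fast exits
  have hthin := NeedleAxisymBand.thinFastExits (hV.of_le (by norm_num)) hax hγ hρ.le (by positivity) hE0 hbA hbE
  -- (R): the race
  exact selfSimilar_ae_eq_zero_of_axisymNoSwirl_thinFastExits hρ hρ1 hsw hH hgauge hu hp hV hax hns one_pos hthin

/-! ### Member level, past-exact about `(T, x₀)`: (S37) unconditional, shifted twin -/

/-- **PAST-EXACT MEMBERS WITH AXISYMMETRIC SWIRL-FREE `C²` PROFILE ARE TRIVIAL (ROUND-37 (S37), shifted twin).**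
Crux hypotheses verbatim (`0 < ρ ≤ ½`) + exact self-similarity about `(T, x₀)` for `τ < T₁` (`T₁ ≤ 0`, `T₁ ≤ T`)
+ `V ∈ C²`, `IsAxisymmetric V`, `HasNoSwirl V` ⇒ `u = 0` a.e. on `(−∞,0) × ℝ³`.
[cite: ConstantinIgnatovaVicol2026Putative, §3.4.1 eq. (3.21)-(3.22), §3.5] -/
theorem selfSimilar_ae_eq_zero_of_axisymNoSwirlC2_past {ρ T T₁ : ℝ} (hρ : 0 < ρ) (hρ1 : ρ ≤ 1 / 2)
    (hT₁ : T₁ ≤ 0) (hTT₁ : T₁ ≤ T) (x₀ : EuclideanSpace ℝ (Fin 3))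
    {u : ℝ → EuclideanSpace ℝ (Fin 3) → EuclideanSpace ℝ (Fin 3)} {p : ℝ → EuclideanSpace ℝ (Fin 3) → ℝ}
    {H : ℝ → EuclideanSpace ℝ (Fin 3) → EuclideanSpace ℝ (Fin 3) →L[ℝ] EuclideanSpace ℝ (Fin 3)} {c : ℝ≥0}
    (hsw : IsSuitableWeakSolutionOn (slab (EuclideanSpace ℝ (Fin 3)) (Iio 0) isOpen_Iio) 0 0 u p)
    (hH : HasWeakSpatialGradientOn (slab (EuclideanSpace ℝ (Fin 3)) (Iio 0) isOpen_Iio) u H)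
    (hgauge : ∀ a : ℝ, 0 < a →
      ENNReal.ofReal (a ^ (2 * ρ)) * cknA a (0 : ℝ × EuclideanSpace ℝ (Fin 3)) u +
          ENNReal.ofReal (a ^ ρ) * cknE a (0 : ℝ × EuclideanSpace ℝ (Fin 3)) H +
        ENNReal.ofReal (a ^ (2 * ρ)) * cknD a (0 : ℝ × EuclideanSpace ℝ (Fin 3)) p ≤ (c : ℝ≥0∞))
    {P : EuclideanSpace ℝ (Fin 3) → ℝ}
    (hu : ∀ τ : ℝ, τ < T₁ → u τ = fun x => selfSimilarCollapse (1 / (2 + ρ)) T V τ (x - x₀))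
    (hp : ∀ τ : ℝ, τ < T₁ → p τ = fun x => selfSimilarCollapsePressure (1 / (2 + ρ)) T P τ (x - x₀))
    (hV : ContDiff ℝ 2 V) (hax : IsAxisymmetric V) (hns : HasNoSwirl V) :
    uncurry u =ᵐ[volume.restrict (Iio (0 : ℝ) ×ˢ (univ : Set (EuclideanSpace ℝ (Fin 3))))] 0 := by
  have hρ1' : ρ < 1 := by linarith
  have h2ρ : (0 : ℝ) < 2 + ρ := by linarith
  have hγ : (0 : ℝ) < 1 / (2 + ρ) := one_div_pos.2 h2ρ
  have hL₁ : (2 : ℝ) ≤ 2 - T₁ := by linarith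
  have hA : ∀ a : ℝ, 0 < a → ENNReal.ofReal (a ^ (2 * ρ)) *
      cknA a (0 : ℝ × EuclideanSpace ℝ (Fin 3)) u ≤ (c : ℝ≥0∞) :=
    fun a ha => le_trans (le_trans le_self_add le_self_add) (hgauge a ha)
  have hE : ∀ a : ℝ, 0 < a → ENNReal.ofReal (a ^ ρ) *
      cknE a (0 : ℝ × EuclideanSpace ℝ (Fin 3)) H ≤ (c : ℝ≥0∞) :=
    fun a ha => le_trans (le_trans le_add_self le_self_add) (hgauge a ha)
  -- the class budgets of the profile (large scales from the far past, patched down to `L ≥ 1`)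
  obtain ⟨CA, hCA, hgrA⟩ := Shifted.profile_energy_growth_of_gaugeA_past hρ hρ1 hT₁ hTT₁ x₀ hu hA
  obtain ⟨CE, hCE, hgrE⟩ :=
    lintegral_fderiv_sq_ball_le_of_past hρ hρ1' hT₁ hTT₁ x₀ hH hu hE (hV.of_le one_le_two)
  have hbA : ∀ L : ℝ, 1 ≤ L →
      ∫⁻ z in closedBall (0 : EuclideanSpace ℝ (Fin 3)) L, ‖V z‖ₑ ^ 2 ≤
        ENNReal.ofReal (CA.toReal * (2 - T₁) ^ (1 - 2 * ρ) * L ^ (1 - 2 * ρ)) :=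
    fun L hL => lintegral_closedBall_le_of_ballGrowth hCA hL₁ hgrA hL
  have hbE : ∀ L : ℝ, 1 ≤ L →
      ∫⁻ z in closedBall (0 : EuclideanSpace ℝ (Fin 3)) L, ‖fderiv ℝ V z‖ₑ ^ 2 ≤
        ENNReal.ofReal (CE.toReal * (2 - T₁) ^ (1 - ρ) * L ^ (1 - ρ)) :=
    fun L hL => lintegral_closedBall_le_of_ballGrowth hCE hL₁ hgrE hL
  have hcA0 : 0 ≤ CA.toReal * (2 - T₁) ^ (1 - 2 * ρ) :=
    mul_nonneg ENNReal.toReal_nonneg (Real.rpow_nonneg (by linarith) _)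
  have hcE0 : 0 ≤ CE.toReal * (2 - T₁) ^ (1 - ρ) :=
    mul_nonneg ENNReal.toReal_nonneg (Real.rpow_nonneg (by linarith) _)
  -- (K): thin fast exits
  have hthin := NeedleAxisymBand.thinFastExits (hV.of_le (by norm_num)) hax hγ hρ.le hcA0 hcE0 hbA hbE
  -- (R): the race, past twin
  exact selfSimilar_ae_eq_zero_of_axisymNoSwirl_thinFastExits_past hρ hρ1 hT₁ hTT₁ x₀ hsw hH hgauge hu hp hV
    hax hns one_pos hthin

end Summit.NavierStokesRegularity.NavierStokesRegularity.Theorems.PowerGaugeEulerLiouville.NeedleRace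

end
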